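import Summits.ValiantsHypothesis.ValiantsHypothesis.Theorems.BarrierLeverNaturalProofsSeparateVNPExponentOne
import Literature.Computability.AlgebraicComplexity.BLMW11KroneckerApproximation
import Literature.Computability.AlgebraicComplexity.ValiantCompleteness
import Literature.Computability.AlgebraicComplexity.HomogeneousComponentsComplexity
import Literature.Computability.AlgebraicComplexity.IMMInVPProofs

/-!
# Route BarrierLever — item `NaturalProofsSeparateVNP` (stmt-ValiantsHypothesis-18972) implies the
# BORDER separations `VNP ⊄ \overline{VP}` and `(per_n) ∉ \overline{VP}` (cell valiant-natproofs,
# seat val-np-p4; bears on ladder rung V4, and links it to the border / GCT column)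

`S := Theses.BarrierLever.NaturalProofsSeparateVNP` — "for one definability exponent `b₁`, for
every size exponent `b`, infinitely often in `n`, a LEVEL-ONE algebraically natural proof against
`SmallCircuits ℂ n b` is nonzero at a member of the `VNP`-succinct class `SmallDefinable ℂ n b₁`" —
is the NEGATIVE horn of the cell's win–win; the sibling file `…NaturalProofsSeparateVNPStatus`
shows `S ⇒ VP ≠ VNP`. This file sharpens that pin, UNCONDITIONALLY and without closing the item:
an algebraically natural proof in the sense of Forbes–Shpilka–Volk is automatically a BORDER lower
bound (its equation vanishes on the Zariski closure of the small circuits), so `S` implies the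
border version of Valiant's hypothesis in the precise sense of Bürgisser–Landsberg–Manivel–Weyman
2011 §9.3 (`\underline{L}`, `\overline{VP}` = the tree's `approxComplexity`, `IsVPBarFamily`:
Zariski closure in coefficient space of the polynomials of circuit size `≤ r`).

* `Border.coeffVec_not_mem_zariskiClosure`, `Border.lt_approxComplexity` — if `D` vanishes on
  `coeff(SmallCircuits ℂ n b)` and `D(coeff g) ≠ 0`, then `coeff g` lies OUTSIDE the Zariski
  closure of `{coeff f : L(f) ≤ R}` whenever `(n+2)² R + (n+1) ≤ n^b`, i.e. `\underline{L}(g) > R`: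
  the pulled-back equation `D ∘ (degree-≤-n coordinates)` kills every size-`R` polynomial `f`
  because those coordinates of `f` are the coordinates of its truncation `Σ_{i ≤ n} f^{(i)}`, a
  member of `SmallCircuits ℂ n b` (BCS 1997 Lemma (21.25), the tree's
  `complexity_sum_homogeneousComponent_le`).
* `Border.not_isVPBarFamily_of_naturalProofAgainstVP` — a target family carrying an algebraically
  natural proof against `VP` of ANY constructivity level is not in `\overline{VP}`;
  `Border.exists_isVNPFamily_not_isVPBarFamily` — **`S ⇒ VNP ⊄ \overline{VP}`** (a p-definable
  family, Bürgisser 2000 Def. 2.5, with `\underline{L}` not p-bounded).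
* `Border.aeval_coeffVec_pullback`, `Border.coeffVec_mem_zariskiClosure_of_homogeneousComponent` —
  the map `P ↦ Ψ(P^{(d)})` (a linear map applied to ONE homogeneous component) is Zariski
  continuous on coefficient vectors: its pull-back of a coefficient-space polynomial is again a
  polynomial, the sum over the finite window of degree-`d` exponents being finite (a substitution of
  constants is NOT continuous on the full, infinite-dimensional coefficient space — whence the
  homogeneous component); `Border.approxComplexity_aeval_le_of_isHomogeneous` — hence a Valiant
  projection of a FORM of degree `d` satisfies `\underline{L}(F(a)) ≤ (d+2)² · \underline{L}(F)`.
* `Border.isVPBarFamily_of_isPProjection_perPoly` — `\overline{VP}` is closed under p-projections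
  from the permanent; with Valiant's completeness theorem as PROVED in the tree
  (`isVNPComplete_perPoly_holds`, `char ℂ ≠ 2`): `Border.not_isVPBarFamily_perPoly` —
  **`S ⇒ (per_n) ∉ \overline{VP}`**, the permanent has superpolynomial approximate (border)
  circuit complexity.

The sequel `…NaturalProofsSeparateVNPBorderDc` adds `S ⇒ BorderDcPerSuperpolynomial`
(Mulmuley–Sohoni / BLMW Conj. 1.1, the GCT column's statement) and the unconditional disjunction
`KRSTForVP ∨ BorderDcPerSuperpolynomial`.

WHAT THIS IS NOT: not a proof or refutation of item 18972 (which stays parked on the crux, item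
14610); not evidence for `VP ≠ VNP`, for `VNP ⊄ \overline{VP}` or for any hardness of the permanent
— every statement here is an implication FROM the open item `S`. That natural proofs give border
lower bounds is folklore (FSV 2018 §1.1, GKSS 2017 §1); new here is only the kernel link between the
tree's V4 statement and the tree's border-complexity vocabulary.

References: [ForbesShpilkaVolk2018] Def. 1, §1.1; [BurgisserEtAl2011] Def. 9.3.1, §9.3;
[BurgisserClausenShokrollahi1997] Lemma (21.25), Thm. (21.17); [Burgisser2000] Def. 2.5–2.6,
Rem. 2.7; [Valiant1979]; [KumarRamyaSaptharishiTengse2022] §1.2.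
-/

-- layout Summits/ValiantsHypothesis/ValiantsHypothesis forces the duplicated namespace component
set_option linter.dupNamespace false

noncomputable section

namespace Summit.ValiantsHypothesis.ValiantsHypothesis.Theorems.BarrierLever.NaturalProofsSeparateVNP

open Literature.Barriers.ValiantsHypothesis Literature.Computability.AlgebraicComplexity MvPolynomial
open Summit.ValiantsHypothesis.ValiantsHypothesis.Theses

namespace Border

/-! ### 1. Degree truncation: the low-degree coefficients of a small circuit are those of a small
circuit OF LOW DEGREE -/

section Truncation

variable {σ : Type*}

/-- The truncation `Σ_{i ≤ e} f^{(i)}` has total degree `≤ e`. [folklore] -/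
theorem totalDegree_truncation_le (e : ℕ) (f : MvPolynomial σ ℂ) :
    (∑ i ∈ Finset.range (e + 1), homogeneousComponent i f).totalDegree ≤ e := by
  refine totalDegree_finsetSum_le fun i hi => ?_
  have hi' : i ≤ e := by have := Finset.mem_range.mp hi; omega
  exact (homogeneousComponent_isHomogeneous i f).totalDegree_le.trans hi'

/-- The truncation `Σ_{i ≤ e} f^{(i)}` has the same coefficients as `f` in degrees `≤ e`.
[folklore] -/
theorem coeff_truncation {e : ℕ} (f : MvPolynomial σ ℂ) {m : σ →₀ ℕ} (hm : m.degree ≤ e) :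
    coeff m (∑ i ∈ Finset.range (e + 1), homogeneousComponent i f) = coeff m f := by
  rw [coeff_sum, Finset.sum_eq_single_of_mem m.degree (Finset.mem_range.mpr (by omega))]
  · rw [coeff_homogeneousComponent, if_pos rfl]
  · intro i _ hi
    rw [coeff_homogeneousComponent, if_neg (Ne.symm hi)]

/-- In the regime `d = n`: the coefficient vector on `degLEMonomials n` does not see the
truncation to degree `≤ n`. [cite: ForbesShpilkaVolk2018, Def. 1] -/
theorem coeffVector_truncation (n : ℕ) (f : MvPolynomial (Fin n) ℂ) :
    coeffVector (degLEMonomials n) (∑ i ∈ Finset.range (n + 1), homogeneousComponent i f) =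
      coeffVector (degLEMonomials n) f := by
  funext m
  exact coeff_truncation f m.2

/-- A polynomial of circuit size `≤ R` truncates to a member of `SmallCircuits ℂ n b` as soon as
`(n+2)² R + (n+1) ≤ n^b` (BCS 1997 Lemma (21.25): all homogeneous components up to degree `n`
cost `(n+2)² L(f) + (n+1)`). [cite: BurgisserClausenShokrollahi1997, Lemma (21.25)] -/
theorem truncation_mem_smallCircuits {n b R : ℕ} {f : MvPolynomial (Fin n) ℂ}
    (hf : complexity f ≤ R) (hR : (n + 2) ^ 2 * R + (n + 1) ≤ n ^ b) :
    (∑ i ∈ Finset.range (n + 1), homogeneousComponent i f) ∈ SmallCircuits ℂ n b := by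
  refine ⟨totalDegree_truncation_le n f, ?_⟩
  calc complexity (∑ i ∈ Finset.range (n + 1), homogeneousComponent i f)
      ≤ (n + 2) ^ 2 * complexity f + (n + 1) := complexity_sum_homogeneousComponent_le f n
    _ ≤ (n + 2) ^ 2 * R + (n + 1) := by gcongr
    _ ≤ n ^ b := hR

end Truncation

/-! ### 2. A natural proof puts its non-roots OUTSIDE the Zariski closure of the small circuits -/

section Escape

/-- **Equations vanish on closures.** If `D` (a polynomial in the `N = C(2n,n)` coefficient
variables) vanishes on `coeff(SmallCircuits ℂ n b)` and `(n+2)² R + (n+1) ≤ n^b`, then every `g`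
with `D(coeff g) ≠ 0` has its (full) coefficient vector OUTSIDE the Zariski closure of the
coefficient vectors of ALL polynomials of circuit size `≤ R` (any degree): the equation
`D ∘ (restriction to degree-≤-n coordinates)` vanishes on that set, because the low-degree
coefficients of a size-`R` circuit are those of its cheap truncation. (FSV 2018 §1.1: natural
proofs prove BORDER lower bounds.) [cite: ForbesShpilkaVolk2018, §1.1] -/
theorem coeffVec_not_mem_zariskiClosure {n b R : ℕ} {D : MvPolynomial (degLEMonomials n) ℂ}
    (hvan : ∀ f ∈ SmallCircuits ℂ n b, eval (coeffVector (degLEMonomials n) f) D = 0)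
    {g : MvPolynomial (Fin n) ℂ} (hg : eval (coeffVector (degLEMonomials n) g) D ≠ 0)
    (hR : (n + 2) ^ 2 * R + (n + 1) ≤ n ^ b) :
    coeffVec g ∉ zariskiClosure (coeffVec '' {f : MvPolynomial (Fin n) ℂ | complexity f ≤ R}) := by
  intro hmem
  rw [mem_zariskiClosure_iff] at hmem
  have hcomp : ∀ f : MvPolynomial (Fin n) ℂ,
      (coeffVec f ∘ fun m : degLEMonomials n => (m : Fin n →₀ ℕ)) =
        coeffVector (degLEMonomials n) f := fun f => rfl
  have key := hmem (rename (fun m : degLEMonomials n => (m : Fin n →₀ ℕ)) D) ?_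
  · apply hg
    rw [aeval_rename, hcomp, aeval_eq_eval] at key
    exact key
  · rintro _ ⟨f, hf, rfl⟩
    rw [aeval_rename, hcomp, aeval_eq_eval, ← coeffVector_truncation n f]
    exact hvan _ (truncation_mem_smallCircuits hf hR)

/-- Hence such a `g` has APPROXIMATE (border) complexity `\underline{L}(g) > R`
(BLMW 2011 Def. 9.3.1: `\underline{L}(g)` = least `r` with `coeff g` in the Zariski closure of
`{coeff f : L(f) ≤ r}`; the infimum is attained since `r = L(g)` qualifies).
[cite: BurgisserEtAl2011, Def. 9.3.1] -/
theorem lt_approxComplexity {n b R : ℕ} {D : MvPolynomial (degLEMonomials n) ℂ}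
    (hvan : ∀ f ∈ SmallCircuits ℂ n b, eval (coeffVector (degLEMonomials n) f) D = 0)
    {g : MvPolynomial (Fin n) ℂ} (hg : eval (coeffVector (degLEMonomials n) g) D ≠ 0)
    (hR : (n + 2) ^ 2 * R + (n + 1) ≤ n ^ b) :
    R < approxComplexity g := by
  by_contra hle
  rw [not_lt] at hle
  have hne : {r : ℕ | coeffVec g ∈ zariskiClosure
      (coeffVec '' {f : MvPolynomial (Fin n) ℂ | complexity f ≤ r})}.Nonempty :=
    ⟨complexity g, subset_zariskiClosure _ ⟨g, show complexity g ≤ complexity g from le_rfl, rfl⟩⟩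
  have hmem := Nat.sInf_mem hne
  refine coeffVec_not_mem_zariskiClosure hvan hg hR (zariskiClosure_mono ?_ hmem)
  rintro _ ⟨f, hf, rfl⟩
  exact ⟨f, le_trans hf hle, rfl⟩

end Escape

/-! ### 3. The item forces a `VNP` family outside `\overline{VP}` -/

section VNPNotInVPBar

/-- Truncation budget: `(n+2)² · A(n+1)^B + (n+1) ≤ n^(B+3)` for all large `n`. [folklore] -/
theorem truncation_budget (A B : ℕ) :
    ∃ n₀ : ℕ, ∀ n : ℕ, n₀ ≤ n → (n + 2) ^ 2 * (A * (n + 1) ^ B) + (n + 1) ≤ n ^ (B + 3) := by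
  refine ⟨4 * A * 2 ^ B + 2, fun n hn => ?_⟩
  have h2 : 2 ≤ n := le_trans (Nat.le_add_left 2 _) hn
  have h1 : (n + 2) ^ 2 ≤ 4 * n ^ 2 := by
    calc (n + 2) ^ 2 ≤ (2 * n) ^ 2 := Nat.pow_le_pow_left (by omega) 2
      _ = 4 * n ^ 2 := by ring
  have h3 : (n + 1) ^ B ≤ 2 ^ B * n ^ B := by
    calc (n + 1) ^ B ≤ (2 * n) ^ B := Nat.pow_le_pow_left (by omega) B
      _ = 2 ^ B * n ^ B := by rw [mul_pow]
  have h4 : n + 1 ≤ 2 * n ^ (B + 2) := by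
    calc n + 1 ≤ 2 * n := by omega
      _ = 2 * n ^ 1 := by rw [pow_one]
      _ ≤ 2 * n ^ (B + 2) := Nat.mul_le_mul_left 2 (Nat.pow_le_pow_right (by omega) (by omega))
  calc (n + 2) ^ 2 * (A * (n + 1) ^ B) + (n + 1)
      ≤ 4 * n ^ 2 * (A * (2 ^ B * n ^ B)) + 2 * n ^ (B + 2) :=
        Nat.add_le_add (Nat.mul_le_mul h1 (Nat.mul_le_mul_left A h3)) h4
    _ = (4 * A * 2 ^ B + 2) * n ^ (B + 2) := by ring
    _ ≤ n * n ^ (B + 2) := Nat.mul_le_mul_right _ hn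
    _ = n ^ (B + 3) := by ring

/-- **A target family carrying an algebraically natural proof against `VP` (any constructivity
level `a`) is NOT in `\overline{VP}`** (BLMW 2011 §9.3: `\underline{L}(h_n)` is not p-bounded):
if `\underline{L}(h_n) ≤ A(n+1)^B`, query the natural proof at size exponent `b = B + 3`; the
distinguisher's non-root `h_n` would have `\underline{L}(h_n) > A(n+1)^B` by
`lt_approxComplexity`. The distinguisher class plays no role: natural proofs in FSV's sense are
border lower bounds. [cite: ForbesShpilkaVolk2018, §1.1] [cite: BurgisserEtAl2011, §9.3] -/
theorem not_isVPBarFamily_of_naturalProofAgainstVP {a : ℕ} {h : ∀ n, MvPolynomial (Fin n) ℂ}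
    (hnat : NaturalProofAgainstVP ℂ a h) : ¬ IsVPBarFamily h := by
  intro hbar
  obtain ⟨A, B, hAB⟩ := (IsPBounded.iff_exists_le_mul_succ_pow _).1 hbar
  obtain ⟨n₀, hn₀⟩ := truncation_budget A B
  obtain ⟨n, hn, D, ⟨-, -, hvan⟩, hne⟩ := hnat (B + 3) n₀
  exact absurd (hAB n) (not_le.mpr (lt_approxComplexity hvan hne (hn₀ n hn)))

/-- Pointwise membership in the `VNP`-succinct class `SmallDefinable ℂ n 1` makes a family
p-definable (Bürgisser 2000, Def. 2.5: `h_n = Σ_{e ∈ {0,1}^{u_n}} G_n(x, e)` with `(G_n) ∈ VP`).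
[cite: Burgisser2000, Def. 2.5] -/
theorem isVNPFamily_of_mem_smallDefinable_one {h : ∀ n, MvPolynomial (Fin n) ℂ}
    (hh : ∀ n, h n ∈ SmallDefinable ℂ n 1) : IsVNPFamily h := by
  have pb : ∀ (t : ℕ → ℕ) (A B : ℕ), (∀ n, t n ≤ A * (n + 1) ^ B) → IsPBounded t := fun t A B ht =>
    (IsPBounded.iff_exists_le_mul_succ_pow t).2 ⟨A, B, ht⟩
  have hh' : ∀ n, ∃ (u : ℕ) (G : MvPolynomial (Fin n ⊕ Fin u) ℂ), u ≤ n ∧ complexity G ≤ n ∧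
      G.totalDegree ≤ n ∧ (h n).totalDegree ≤ n ∧ h n = boolSum G := by
    intro n
    obtain ⟨hdeg, u, hu, G, hGc, hGd, hGeq⟩ := hh n
    rw [pow_one] at hu hGc hGd
    exact ⟨u, G, hu, hGc, hGd, hdeg, hGeq⟩
  choose u G hu hGc hGd hdeg hGeq using hh'
  have hle : ∀ n, n ≤ (n + 1) ^ 1 := fun n => by rw [pow_one]; exact Nat.le_succ n
  have hle1 : ∀ n, n ≤ 1 * (n + 1) ^ 1 := fun n => by rw [one_mul]; exact hle n
  refine ⟨⟨pb _ 1 1 fun n => ?_, pb _ 1 1 fun n => (hdeg n).trans (hle1 n)⟩, u, G,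
    ⟨⟨pb _ 2 1 fun n => ?_, pb _ 1 1 fun n => (hGd n).trans (hle1 n)⟩,
      pb _ 1 1 fun n => (hGc n).trans (hle1 n)⟩, hGeq⟩
  · rw [Fintype.card_fin]; exact hle1 n
  · rw [Fintype.card_sum, Fintype.card_fin, Fintype.card_fin, two_mul]
    exact Nat.add_le_add (hle n) ((hu n).trans (hle n))

/-- **Item 18972 ⇒ `VNP ⊄ \overline{VP}`.** A level-one natural proof separating `VNP` from `VP`
infinitely often (the item, in its family form `naturalProofsSeparateVNP_iff_exists_family`)
exhibits a p-definable family whose approximate complexity `\underline{L}` (BLMW 2011 Def. 9.3.1,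
Zariski closure in coefficient space) is not polynomially bounded. This is the border version of
the summit `ValiantsHypothesis` (`VNP ⊄ VP`), a priori stronger.
[cite: BurgisserEtAl2011, Def. 9.3.1 and §9.3] [cite: ForbesShpilkaVolk2018, §1.1] -/
theorem exists_isVNPFamily_not_isVPBarFamily (hS : BarrierLever.NaturalProofsSeparateVNP) :
    ∃ h : ∀ n, MvPolynomial (Fin n) ℂ, IsVNPFamily h ∧ ¬ IsVPBarFamily h := by
  obtain ⟨h, hdef, hnat⟩ := naturalProofsSeparateVNP_iff_exists_family.mp hS
  exact ⟨h, isVNPFamily_of_mem_smallDefinable_one hdef, not_isVPBarFamily_of_naturalProofAgainstVP hnat⟩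

end VNPNotInVPBar

/-! ### 4. Substitutions are Zariski-continuous on each homogeneous component -/

section Pullback

variable {σ τ : Type*} [Fintype σ] [DecidableEq σ]

/-- The finite window of all exponent vectors of degree `d` (on finitely many variables).
[folklore] -/
theorem mem_finsuppAntidiag_univ_iff {d : ℕ} {ν : σ →₀ ℕ} :
    ν ∈ (Finset.univ : Finset σ).finsuppAntidiag d ↔ ν.degree = d := by
  rw [Finset.mem_finsuppAntidiag, Finsupp.degree_eq_sum]
  simp

/-- The degree-`d` homogeneous component as a sum over the fixed window of all degree-`d`
exponent vectors. [folklore] -/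
theorem homogeneousComponent_eq_sum_univ (d : ℕ) (P : MvPolynomial σ ℂ) :
    homogeneousComponent d P =
      ∑ ν ∈ (Finset.univ : Finset σ).finsuppAntidiag d, monomial ν (coeff ν P) := by
  rw [homogeneousComponent_apply]
  refine Finset.sum_subset (fun ν hν => ?_) (fun ν hν hν' => ?_)
  · rw [Finset.mem_filter] at hν
    exact mem_finsuppAntidiag_univ_iff.mpr hν.2
  · have hdeg := mem_finsuppAntidiag_univ_iff.mp hν
    have hc : coeff ν P = 0 := by
      by_contra hc
      exact hν' (Finset.mem_filter.mpr ⟨mem_support_iff.mpr hc, hdeg⟩)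
    rw [hc, monomial_zero]

/-- **Pull-back of a coefficient-space polynomial along `P ↦ Ψ(P^{(d)})`.** For a linear map
`Ψ` on polynomials, a degree `d`, coordinates `e`, and a polynomial `q` in (some of) the
coefficient coordinates of the target, the polynomial
`Q = q(… Σ_{|ν| = d} coeff_{e i}(Ψ x^ν) · X_ν …)` in the coefficient coordinates of the source
satisfies `Q(coeff P) = q(coeff (Ψ P^{(d)}))` for every `P`. (The restriction to ONE homogeneous
component is what makes the sum finite: with constants substituted, infinitely many monomials of
`P` may contribute to one coefficient of `Ψ P`.) [folklore] -/
theorem aeval_coeffVec_pullback (Ψ : MvPolynomial σ ℂ →ₗ[ℂ] MvPolynomial τ ℂ) (d : ℕ)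
    {ι : Type*} (e : ι → (τ →₀ ℕ)) (q : MvPolynomial ι ℂ) (P : MvPolynomial σ ℂ) :
    aeval (coeffVec P) (bind₁ (fun i => ∑ ν ∈ (Finset.univ : Finset σ).finsuppAntidiag d,
        C (coeff (e i) (Ψ (monomial ν 1))) * X ν) q) =
      aeval (fun i => coeff (e i) (Ψ (homogeneousComponent d P))) q := by
  have hmon : ∀ (ν : σ →₀ ℕ) (c : ℂ), monomial ν c = c • monomial ν (1 : ℂ) := fun ν c => by
    rw [smul_monomial, smul_eq_mul, mul_one]
  have key : ∀ i, aeval (coeffVec P) (∑ ν ∈ (Finset.univ : Finset σ).finsuppAntidiag d,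
      C (coeff (e i) (Ψ (monomial ν 1))) * X ν) = coeff (e i) (Ψ (homogeneousComponent d P)) := by
    intro i
    rw [map_sum, homogeneousComponent_eq_sum_univ, map_sum, coeff_sum]
    refine Finset.sum_congr rfl fun ν _ => ?_
    rw [map_mul, aeval_C, aeval_X, Algebra.algebraMap_self_apply, coeffVec_apply, hmon ν (coeff ν P),
      map_smul, coeff_smul, smul_eq_mul, mul_comm]
  simp only [aeval_bind₁, key]

/-- **Zariski continuity of `P ↦ Ψ(P^{(d)})` on coefficient vectors.** If `coeff P` lies in the
Zariski closure of `coeff(S)` and `Ψ` maps the degree-`d` components of `S` into `T`, then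
`coeff (Ψ P^{(d)})` lies in the Zariski closure of `coeff(T)` (pull the test polynomial back by
`aeval_coeffVec_pullback`). Mumford, Red book I §2 (polynomial maps are Zariski continuous).
[folklore] -/
theorem coeffVec_mem_zariskiClosure_of_homogeneousComponent
    (Ψ : MvPolynomial σ ℂ →ₗ[ℂ] MvPolynomial τ ℂ) (d : ℕ) {S : Set (MvPolynomial σ ℂ)}
    {T : Set (MvPolynomial τ ℂ)} (hST : ∀ g ∈ S, Ψ (homogeneousComponent d g) ∈ T)
    {P : MvPolynomial σ ℂ} (hP : coeffVec P ∈ zariskiClosure (coeffVec '' S)) :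
    coeffVec (Ψ (homogeneousComponent d P)) ∈ zariskiClosure (coeffVec '' T) := by
  rw [mem_zariskiClosure_iff] at hP ⊢
  intro q hq
  have key := hP (bind₁ (fun μ : τ →₀ ℕ => ∑ ν ∈ (Finset.univ : Finset σ).finsuppAntidiag d,
    C (coeff μ (Ψ (monomial ν 1))) * X ν) q) ?_
  · rw [aeval_coeffVec_pullback] at key
    exact key
  · rintro _ ⟨g, hg, rfl⟩
    rw [aeval_coeffVec_pullback]
    exact hq _ ⟨_, hST g hg, rfl⟩

/-- **Projections of forms do not increase approximate complexity beyond the homogenisation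
factor:** for `F` homogeneous of degree `d` and a substitution `a` of variables by polynomials of
complexity `0` (variables and constants — a Valiant projection), `\underline{L}(F(a)) ≤ (d+2)² ·
\underline{L}(F)`: the degree-`d` components of the size-`r` approximants of `F` cost
`(d+2)² r` (BCS 1997 Lemma (21.25)) and project to approximants of `F(a)`.
[cite: BurgisserEtAl2011, Def. 9.3.1] [cite: BurgisserClausenShokrollahi1997, Lemma (21.25)] -/
theorem approxComplexity_aeval_le_of_isHomogeneous [Fintype τ] [DecidableEq τ]
    {F : MvPolynomial σ ℂ} {d : ℕ}
    (hF : F.IsHomogeneous d) (a : σ → MvPolynomial τ ℂ) (ha : ∀ i, complexity (a i) = 0) :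
    approxComplexity (aeval a F) ≤ (d + 2) ^ 2 * approxComplexity F := by
  set r := approxComplexity F with hr
  have hne : {r : ℕ | coeffVec F ∈ zariskiClosure
      (coeffVec '' {g : MvPolynomial σ ℂ | complexity g ≤ r})}.Nonempty :=
    ⟨complexity F, subset_zariskiClosure _ ⟨F, show complexity F ≤ complexity F from le_rfl, rfl⟩⟩
  have hF' : coeffVec F ∈ zariskiClosure (coeffVec '' {g : MvPolynomial σ ℂ | complexity g ≤ r}) :=
    Nat.sInf_mem hne
  have himg := coeffVec_mem_zariskiClosure_of_homogeneousComponent (aeval a).toLinearMap d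
    (S := {g : MvPolynomial σ ℂ | complexity g ≤ r})
    (T := {g' : MvPolynomial τ ℂ | complexity g' ≤ (d + 2) ^ 2 * r}) (fun g hg => ?_) hF'
  · rw [AlgHom.toLinearMap_apply, homogeneousComponent_eq_self hF] at himg
    exact Nat.sInf_le himg
  · show complexity (aeval a (homogeneousComponent d g)) ≤ (d + 2) ^ 2 * r
    calc complexity (aeval a (homogeneousComponent d g))
        ≤ complexity (homogeneousComponent d g) + ∑ i, complexity (a i) := complexity_aeval_le _ _
      _ = complexity (homogeneousComponent d g) := by simp [ha]
      _ ≤ (d + 2) ^ 2 * complexity g := complexity_homogeneousComponent_le_sq_mul g d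
      _ ≤ (d + 2) ^ 2 * r := Nat.mul_le_mul_left _ hg

end Pullback

/-! ### 5. The item puts the permanent outside `\overline{VP}` -/

section Permanent

/-- **`\overline{VP}` is closed under p-projections FROM the permanent** (more generally from any
family of forms): if `h` is a p-projection of `(per_n)` and `\underline{L}(per_n)` is p-bounded then
so is `\underline{L}(h_n)`, by `approxComplexity_aeval_le_of_isHomogeneous` (`per_t` is a form of
degree `t`) and closure of p-bounded functions under `+, ·, ∘`.
[cite: BurgisserEtAl2011, §9.3] [cite: Burgisser2000, Def. 2.6] -/
theorem isVPBarFamily_of_isPProjection_perPoly {v : ℕ → ℕ} {h : ∀ n, MvPolynomial (Fin (v n)) ℂ}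
    (hproj : IsPProjection h fun n => perPoly (Fin n) ℂ)
    (hper : IsVPBarFamily fun n => perPoly (Fin n) ℂ) : IsVPBarFamily h := by
  obtain ⟨t, ht, hpr⟩ := hproj
  have hbound : ∀ n, approxComplexity (h n) ≤
      (t n + 2) ^ 2 * approxComplexity (perPoly (Fin (t n)) ℂ) := by
    intro n
    obtain ⟨a, ha, heq⟩ := hpr n
    rw [heq]
    refine approxComplexity_aeval_le_of_isHomogeneous ?_ a fun i => ?_
    · simpa only [Fintype.card_fin] using (perPoly_isHomogeneous (n := Fin (t n)) (k := ℂ))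
    · rcases ha i with ⟨j, hj⟩ | ⟨c, hc⟩
      · rw [hj]; exact complexity_X_holds _
      · rw [hc]; exact complexity_C_holds _
  refine IsPBounded.mono ?_ hbound
  exact IsPBounded.mul_holds (IsPBounded.pow_holds (IsPBounded.add_holds ht (IsPBounded.const 2)) 2)
    (IsPBounded.comp_holds hper ht)

/-- **Item 18972 ⇒ `(per_n) ∉ \overline{VP}`** — the permanent has superpolynomial APPROXIMATE
(border) circuit complexity: the `VNP` family outside `\overline{VP}` of
`exists_isVNPFamily_not_isVPBarFamily` is a p-projection of the permanent (Valiant 1979, the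
tree's `isVNPComplete_perPoly_holds`; `char ℂ = 0 ≠ 2`), and `\overline{VP}` is closed under
p-projections from the permanent. [cite: Valiant1979] [cite: BurgisserEtAl2011, §9.3] -/
theorem not_isVPBarFamily_perPoly (hS : BarrierLever.NaturalProofsSeparateVNP) :
    ¬ IsVPBarFamily fun n => perPoly (Fin n) ℂ := by
  intro hper
  obtain ⟨h, hVNP, hbar⟩ := exists_isVNPFamily_not_isVPBarFamily hS
  have h2 : ringChar ℂ ≠ 2 := by rw [ringChar.eq_zero]; decide
  have hproj : IsPProjection h fun n => perPoly (Fin n) ℂ :=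
    (isVNPComplete_perPoly_holds ℂ h2).2 (fun n => n) h hVNP
  exact hbar (isVPBarFamily_of_isPProjection_perPoly hproj hper)

end Permanent

end Border

end Summit.ValiantsHypothesis.ValiantsHypothesis.Theorems.BarrierLever.NaturalProofsSeparateVNP

end
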